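import Literature.RingTheory.MvPolynomial.MacaulayBoundProofs
import Mathlib.RingTheory.MvPolynomial.MonomialOrder
import Mathlib.RingTheory.MvPolynomial.Homogeneous
import Mathlib.RingTheory.MvPolynomial.Ideal
import Mathlib.Order.UpperLower.CompleteLattice
import HarnessLib

/-!
# Leading exponents of an ideal and Macaulay's count `dim_k I_d = #(E(I) ∩ Mon_d)`

Topic: `Literature/RingTheory/MvPolynomial`. The step "`H(S_n/I) = H(S_n/I')` for some monomial
ideal `I' ⊂ S_n` … one may take for `I'` the ideal of leading terms for `I`" of the proof of
Cossart–Jannsen–Saito, LNM 2270, Thm. 2.15 (attributed there to Macaulay, via [CLO, 6 §3,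
Prop. 9]), over a field `k` and for any monomial order (Mathlib `MonomialOrder σ`):

* `leadingExponents mo I` — `E(I) = {deg_mo f | f ∈ I, f ≠ 0}`, the exponents of the leading
  monomials of the non-zero members of the ideal `I ⊆ k[X_σ]`; an UPPER SET of `σ →₀ ℕ`
  (`isUpperSet_leadingExponents`), i.e. the exponent set of the monomial ideal `in(I)`.
* `idealDegree I d` — the `k`-subspace `I_d = I ∩ S_d` of forms of degree `d` in `I`.
* `finrank_idealDegree_eq_card` — **for a homogeneous ideal** (every homogeneous component of a
  member is a member) **`dim_k I_d = #{a ∈ E(I) | |a| = d}`** (the two inequalities are the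
  leading-monomial counts `finrank_le_card_of_degree_mem` / `card_le_finrank_of_degree` of
  `MacaulayBoundProofs.lean`; for "≥" one replaces `f ∈ I` with leading exponent `a` of degree
  `d` by its degree-`d` component, which has the same leading exponent).
* Monomial ideals: `leadingExponents_span_monomial` — for an upper set `E`,
  `E(⟨X^a : a ∈ E⟩) = E`; `homogeneousComponent_mem_span_monomial` — monomial ideals are
  homogeneous; hence `finrank_idealDegree_span_monomial` — `dim_k ⟨X^a : a ∈ E⟩_d = #{a ∈ E |
  |a| = d}`.

## Sources

* V. Cossart, U. Jannsen, S. Saito, LNM 2270 (2020), proof of Thm. 2.15. [CossartJannsenSaito2020]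
* D. Cox, J. Little, D. O'Shea, *Ideals, Varieties, and Algorithms*, Ch. 6 §3 (Macaulay: the
  monomials not in `in(I)` form a basis of `S/I`) — as cited there. [folklore]
-/

noncomputable section

open MvPolynomial Finset

namespace Literature.RingTheory.MvPolynomial

variable {K : Type*} [Field K] {σ : Type*} (mo : MonomialOrder σ)

/-! ## Leading exponents -/

/-- **The leading exponents of an ideal**: `E(I) = {deg f | f ∈ I, f ≠ 0}` for the monomial
order `mo` (the exponent set of the initial ideal `in(I)`). [cite: CossartJannsenSaito2020, Thm. 2.15 (proof)] -/
def leadingExponents (I : Ideal (MvPolynomial σ K)) : Set (σ →₀ ℕ) :=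
  {a | ∃ f ∈ I, f ≠ 0 ∧ mo.degree f = a}

/-- Membership in `E(I)`. [folklore] -/
theorem mem_leadingExponents {I : Ideal (MvPolynomial σ K)} {a : σ →₀ ℕ} :
    a ∈ leadingExponents mo I ↔ ∃ f ∈ I, f ≠ 0 ∧ mo.degree f = a := Iff.rfl

/-- **`E(I)` is an upper set**: if `a = deg f` and `a ≤ b` then `b = deg (X^{b-a} f)`.
[folklore] -/
theorem isUpperSet_leadingExponents (I : Ideal (MvPolynomial σ K)) :
    IsUpperSet (leadingExponents mo I) := by
  classical
  rintro a b hab ⟨f, hfI, hf0, rfl⟩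
  refine ⟨monomial (b - mo.degree f) (1 : K) * f, I.mul_mem_left _ hfI, ?_, ?_⟩
  · exact mul_ne_zero (monomial_eq_zero.not.mpr one_ne_zero) hf0
  · rw [mo.degree_mul (monomial_eq_zero.not.mpr one_ne_zero) hf0, mo.degree_monomial,
      if_neg one_ne_zero, tsub_add_cancel_of_le hab]

/-- `E(I)` as an `UpperSet`. [folklore] -/
def leadingUpperSet (I : Ideal (MvPolynomial σ K)) : UpperSet (σ →₀ ℕ) :=
  ⟨leadingExponents mo I, isUpperSet_leadingExponents mo I⟩

/-- Unfolding. [folklore] -/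
@[simp] theorem coe_leadingUpperSet (I : Ideal (MvPolynomial σ K)) :
    (↑(leadingUpperSet mo I) : Set (σ →₀ ℕ)) = leadingExponents mo I := rfl

/-- `E` is monotone in the ideal. [folklore] -/
theorem leadingExponents_mono {I J : Ideal (MvPolynomial σ K)} (h : I ≤ J) :
    leadingExponents mo I ⊆ leadingExponents mo J :=
  fun _ ⟨f, hf, hf0, hfa⟩ => ⟨f, h hf, hf0, hfa⟩

/-! ## The degree-`d` part of an ideal -/

/-- The `k`-subspace `I_d = I ∩ S_d` of the forms of degree `d` lying in the ideal `I`.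
[folklore] -/
def idealDegree (I : Ideal (MvPolynomial σ K)) (d : ℕ) : Submodule K (MvPolynomial σ K) :=
  I.restrictScalars K ⊓ homogeneousSubmodule σ K d

/-- Membership in `I_d`. [folklore] -/
theorem mem_idealDegree {I : Ideal (MvPolynomial σ K)} {d : ℕ} {f : MvPolynomial σ K} :
    f ∈ idealDegree I d ↔ f ∈ I ∧ f.IsHomogeneous d := Iff.rfl

/-- `I_d` is finite-dimensional (for finitely many variables). [folklore] -/
instance idealDegree.finite [Finite σ] (I : Ideal (MvPolynomial σ K)) (d : ℕ) :
    Module.Finite K (idealDegree I d) := by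
  haveI : Module.Finite K (homogeneousSubmodule σ K d) :=
    Module.Finite.iff_fg.mpr (homogeneousSubmodule_fg σ K d)
  exact Module.Finite.of_injective (Submodule.inclusion (inf_le_right : idealDegree I d ≤ _))
    (Submodule.inclusion_injective _)

/-- The leading exponent of a non-zero form of degree `d` has degree `d`. [folklore] -/
theorem degree_degree_of_isHomogeneous {f : MvPolynomial σ K} {d : ℕ} (hf : f.IsHomogeneous d)
    (hf0 : f ≠ 0) : (mo.degree f).degree = d := by
  have h1 : Finsupp.degree (mo.degree f) = Finsupp.weight (fun _ => 1) (mo.degree f) :=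
    DFunLike.congr_fun Finsupp.degree_eq_weight_one _
  rw [h1]
  exact hf (mem_support_iff.mp ((mo.degree_mem_support_iff f).mpr hf0))

/-- **The degree-`d` component of `f` has the same leading exponent as `f` when that exponent has
degree `d`** (and is then non-zero). [folklore] -/
theorem degree_homogeneousComponent_eq {f : MvPolynomial σ K} (hf0 : f ≠ 0) {d : ℕ}
    (hd : (mo.degree f).degree = d) :
    homogeneousComponent d f ≠ 0 ∧ mo.degree (homogeneousComponent d f) = mo.degree f := by
  have hcoeff : coeff (mo.degree f) (homogeneousComponent d f) ≠ 0 := by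
    rw [coeff_homogeneousComponent, if_pos hd]
    exact mo.coeff_degree_ne_zero_iff.mpr hf0
  have hne : homogeneousComponent d f ≠ 0 := fun h => hcoeff (by rw [h, coeff_zero])
  refine ⟨hne, mo.toSyn.injective (le_antisymm ?_ ?_)⟩
  · refine mo.degree_le_iff.mpr fun c hc => mo.le_degree ?_
    rw [mem_support_iff] at hc ⊢
    rw [coeff_homogeneousComponent] at hc
    split_ifs at hc with h
    · exact hc
    · exact absurd rfl hc
  · exact mo.le_degree (mem_support_iff.mpr hcoeff)

/-- **Macaulay's count: `dim_k I_d = #{a ∈ E(I) | |a| = d}` for a homogeneous ideal `I`.**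
(Homogeneity is used in the explicit form: all homogeneous components of members are members.)
[cite: CossartJannsenSaito2020, Thm. 2.15 (proof)] -/
theorem finrank_idealDegree_eq_card [Fintype σ] [DecidableEq σ] (I : Ideal (MvPolynomial σ K))
    (hI : ∀ f ∈ I, ∀ d : ℕ, homogeneousComponent d f ∈ I) (d : ℕ)
    [DecidablePred (· ∈ leadingExponents mo I)] :
    Module.finrank K (idealDegree I d) =
      (((univ : Finset σ).finsuppAntidiag d).filter (· ∈ leadingExponents mo I)).card := by
  apply le_antisymm
  · refine finrank_le_card_of_degree_mem mo fun v hv hv0 => ?_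
    rw [mem_filter, mem_finsuppAntidiag_univ_iff]
    exact ⟨degree_degree_of_isHomogeneous mo hv.2 hv0, v, hv.1, hv0, rfl⟩
  · refine card_le_finrank_of_degree mo fun μ hμ => ?_
    rw [mem_filter, mem_finsuppAntidiag_univ_iff] at hμ
    obtain ⟨hμd, f, hfI, hf0, rfl⟩ := hμ
    obtain ⟨hne, hdeg⟩ := degree_homogeneousComponent_eq mo hf0 hμd
    exact ⟨homogeneousComponent d f, ⟨hI f hfI d, homogeneousComponent_isHomogeneous d f⟩, hne,
      hdeg⟩

/-! ## Monomial ideals -/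

/-- **The leading exponents of a monomial ideal `⟨X^a : a ∈ E⟩` with `E` an upper set are `E`.**
[folklore] -/
theorem leadingExponents_span_monomial {E : Set (σ →₀ ℕ)} (hE : IsUpperSet E) :
    leadingExponents mo (Ideal.span ((fun a => monomial a (1 : K)) '' E)) = E := by
  classical
  ext a
  constructor
  · rintro ⟨f, hf, hf0, rfl⟩
    obtain ⟨b, hb, hba⟩ :=
      mem_ideal_span_monomial_image.mp hf _ ((mo.degree_mem_support_iff f).mpr hf0)
    exact hE hba hb
  · intro ha
    refine ⟨monomial a 1, Ideal.subset_span ⟨a, ha, rfl⟩, monomial_eq_zero.not.mpr one_ne_zero, ?_⟩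
    rw [mo.degree_monomial, if_neg one_ne_zero]

/-- **Monomial ideals are homogeneous**: every homogeneous component of a member of
`⟨X^a : a ∈ E⟩` is a member (its support is part of the member's support). [folklore] -/
theorem homogeneousComponent_mem_span_monomial (E : Set (σ →₀ ℕ)) {f : MvPolynomial σ K}
    (hf : f ∈ Ideal.span ((fun a => monomial a (1 : K)) '' E)) (d : ℕ) :
    homogeneousComponent d f ∈ Ideal.span ((fun a => monomial a (1 : K)) '' E) := by
  rw [mem_ideal_span_monomial_image] at hf ⊢
  intro c hc
  apply hf
  rw [mem_support_iff] at hc ⊢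
  rw [coeff_homogeneousComponent] at hc
  split_ifs at hc with h
  · exact hc
  · exact absurd rfl hc

include mo in
/-- Hence **`dim_k ⟨X^a : a ∈ E⟩_d = #{a ∈ E | |a| = d}`** for an upper set `E`. [folklore] -/
theorem finrank_idealDegree_span_monomial [Fintype σ] [DecidableEq σ] {E : Set (σ →₀ ℕ)}
    (hE : IsUpperSet E) (d : ℕ) [DecidablePred (· ∈ E)] :
    Module.finrank K (idealDegree (Ideal.span ((fun a => monomial a (1 : K)) '' E)) d) =
      (((univ : Finset σ).finsuppAntidiag d).filter (· ∈ E)).card := by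
  classical
  have h := finrank_idealDegree_eq_card mo (Ideal.span ((fun a => monomial a (1 : K)) '' E))
    (fun f hf d => homogeneousComponent_mem_span_monomial E hf d) d
  rw [h]
  congr 1
  ext a
  simp only [mem_filter, leadingExponents_span_monomial mo hE]

end Literature.RingTheory.MvPolynomial

end
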